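import Literature.MathematicalPhysics.QuantumLattice.DWaveSourceWindowCertificateFieldRows
import HarnessLib

/-!
# PINNING-FIELD rows: CANONICAL-CLASS node shapes of «KKT + energy window» / «chord ⊕ KKT» pair legs at fixed filling —
# the energy rows fed by the cell's canonical CAP nodes and E-leg FLOOR nodes

HONEST FRAMING: soundness glue; no certificate, no number, no order parameter, no phase word. A finite-`h` response bound is a
response, never an order parameter (cell hubbard-cq wording W1).

WHAT THIS FILE IS (cell hubbard-cq, D-0082 (c) / LADDER row PC-a, seat hubbard-cq-obsth-1 «pinning-field K5 menu nodes with the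
pinning term»). The CANONICAL K-leg the cell can run without declaring a chemical potential (obsth-1 INBOX 2026-08-27T04:50Z; reader
`Literature/…/DWaveSourceCanonicalClassWindowCertificate` + `…FieldRows` §4): filling rows at `n/2`, the 16-op flip-twisted
symmetrisation, `eom` / `kkt` rows on NUMBER-CONSERVING words computed with the `μ = 0` window Hamiltonian
`H₀ = pairSourceWindowHamiltonianTT' dWaveFormFactor Λ' t' U 0 h`, a CAP row at the program's field `h` fed by a canonical cap node
«`∃ σ TI, ρ(σ) = n, e^{src}_{0,h}(σ) ≤ u`» (p2's `exists_canonicalClass_sourced_le_…`), and FLOOR rows at fields `hⱼ` (the same field: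
energy window; a smaller field: the Griffiths chord inside the SDP) fed by the cell's canonical E-leg nodes
«`∀ σ TI, ρ(σ) = n → ℓⱼ ≤ e^{src}_{0,hⱼ}(σ)`» (pin-1's `cert_pin1_E*` shape). Conclusions, for `0 < n < 2` and a slot `2m ≤ c − Σ‖aₖ‖`:

* `canonicalClass_re_expect_localPairAt_ge_of_twistedFlip_certificate_kkt_of_energyNodes` — for every translation-invariant `ω` of
  density `n` minimising `e^{src}_{0,h}` at density `n` (the class of the cell's canonical response floors): `m ≤ Re ω(P₀^d)`;
* `canonicalClass_re_expect_localPairAt_le_of_twistedFlip_certificate_kkt_of_energyNodes` — MAX twin, `Re ω(P₀^d) ≤ M`.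

Interface note: no local instance, no definition, no named fact, no `sorry`.

References: R. B. Griffiths, Phys. Rev. 152 (1966) 240 §II [Griffiths1966]; J. Wang et al., PRX 14 (2024) 031006 §III [WangEtAl2024];
O. Bratteli, A. Kishimoto, D. W. Robinson, CMP 64 (1978) 41, Thm. 2 [BratteliKishimotoRobinson1978]; T. Koma, H. Tasaki, J. Stat. Phys. 76
(1994) 745 §1 [KomaTasaki1994]; M. Araújo et al., arXiv:2311.18707 §3.2 Prop. 11 [AraujoEtAl2023].
-/

noncomputable section

namespace Summit.Ventures.CertifiedManyBodySolver

open Literature.MathematicalPhysics.QuantumLattice Literature.MathematicalPhysics.QuantumLattice.ThermodynamicLimit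
open Literature.MathematicalPhysics.QuantumManyBody.StateRelaxation
open Matrix HubbardWave0 Literature.Probability.LatticeModels Finset InfVolFermionState
open scoped BigOperators ComplexOrder

variable {t' U h : ℝ}

/-- **CANONICAL «KKT + ENERGY ROWS» FLOOR NODE SHAPE**: certificate at `μ = 0` with filling rows at `n/2`, number-conserving `eom` /
`kkt` blocks, pair MIN objective, cap row `κ⁺ ((u:ℚ)·1 − Γ E^{src}_{0,h})` (`κ⁺ ≥ 0`, canonical cap node `hcapW`), floor rows
`Σⱼ κⱼ (Γ E^{src}_{0,hⱼ} − (ℓⱼ:ℚ)·1)` (`κⱼ ≥ 0`, canonical E-leg nodes `hE`), slot `2m ≤ c − Σ‖aₖ‖` ⇒ for every density-`n` minimiser `ω`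
of `e^{src}_{0,h}`, `m ≤ Re ω(P₀^d)`. [cite: Griffiths1966, §II] [cite: WangEtAl2024, §III] [cite: BratteliKishimotoRobinson1978, Thm. 2] -/
theorem canonicalClass_re_expect_localPairAt_ge_of_twistedFlip_certificate_kkt_of_energyNodes (t' U h n : ℝ) (hn0 : 0 < n)
    (hn2 : n < 2) {Λ Λ' : Finset (Site 2)} (hΛ : Λ ⊆ Λ') (h8 : thicken Λ 1 ⊆ Λ') (h0 : thicken ({0} : Finset (Site 2)) 1 ⊆ Λ')
    (hz : (0 : Site 2) ∈ Λ') (hP : pairRegion (insert (0 : Site 2) unitSteps) 0 ⊆ Λ') {κp : ℝ} (hκ : 0 ≤ κp) {u : ℚ}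
    (hcapW : ∃ σ : InfVolFermionState 2, σ.IsTranslationInvariant ∧ σ.density = n ∧
      σ.meanEnergy (hubbardTTPrimeSourcedInteraction 1 t' U 0 dWaveFormFactor h) 1 ≤ ((u : ℚ) : ℝ))
    {J : Type*} (Jf : Finset J) (κf hf : J → ℝ) (lf : J → ℚ) (hκf : ∀ j ∈ Jf, 0 ≤ κf j)
    (hE : ∀ j ∈ Jf, ∀ σ : InfVolFermionState 2, σ.IsTranslationInvariant → σ.density = n →
      ((lf j : ℚ) : ℝ) ≤ σ.meanEnergy (hubbardTTPrimeSourcedInteraction 1 t' U 0 dWaveFormFactor (hf j)) 1)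
    (μc : Fin 2 → ℝ)
    {m : Type*} [Fintype m] [DecidableEq m] {Λm : Matrix m m ℂ} (hΛm : Λm.PosSemidef) (O : m → FermionOp Λ')
    {κ' : Type*} (s : Finset κ') (B : κ' → FermionOp Λ) (hB : ∀ k ∈ s, Commute (totalNumber : FermionOp Λ) (B k))
    {ι : Type*} (tt : Finset ι) (γ : ι → DihedralGroup 4) (wv : ι → Site 2) (fl mt : ι → Fin 2)
    (hsh : ∀ l, d4ShiftSet (γ l) (wv l) Λ ⊆ Λ') (bb : ι → ℂ) (yw : ι → List (Orb (PolySite Λ) × Bool))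
    {δ : Type*} (ah : Finset δ) (dc : δ → ℝ) (V : δ → FermionOp Λ')
    {κ'' : Type*} (w : Finset κ'') (a : κ'' → ℂ) (word : κ'' → List (Orb (PolySite Λ') × Bool))
    {β : Type*} [Fintype β] [DecidableEq β] {G : Matrix β β ℂ} (hG : G.PosSemidef) (Bk : β → FermionOp Λ)
    (hBk : ∀ b, Commute (totalNumber : FermionOp Λ) (Bk b)) {c mfl : ℝ} (hm : 2 * mfl ≤ c - ∑ k ∈ w, ‖a k‖)
    (hcert : (fermionEmbed (PolySite.incl hP) (localPairAt (insert (0 : Site 2) unitSteps) dWaveFormFactor 0) +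
          (fermionEmbed (PolySite.incl hP) (localPairAt (insert (0 : Site 2) unitSteps) dWaveFormFactor 0))ᴴ) -
        (c : ℂ) • (1 : FermionOp Λ') -
        ∑ σ : Fin 2, ((μc σ : ℝ) : ℂ) • (nAt 0 hz σ - (((n / 2 : ℝ) : ℝ) : ℂ) • (1 : FermionOp Λ')) -
        ((κp : ℝ) : ℂ) • ((((u : ℚ) : ℝ) : ℂ) • (1 : FermionOp Λ') -
          fermionEmbed (PolySite.incl h0) ((hubbardTTPrimeSourcedInteraction 1 t' U 0 dWaveFormFactor h).meanEnergyObs 1)) -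
        ∑ j ∈ Jf, ((κf j : ℝ) : ℂ) •
          (fermionEmbed (PolySite.incl h0) ((hubbardTTPrimeSourcedInteraction 1 t' U 0 dWaveFormFactor (hf j)).meanEnergyObs 1) -
            (((lf j : ℚ) : ℝ) : ℂ) • (1 : FermionOp Λ')) =
      gramForm Λm O +
        (∑ k ∈ s, (pairSourceWindowHamiltonianTT' dWaveFormFactor Λ' t' U 0 h * fermionEmbed (PolySite.incl hΛ) (B k) -
            fermionEmbed (PolySite.incl hΛ) (B k) * pairSourceWindowHamiltonianTT' dWaveFormFactor Λ' t' U 0 h) +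
          ∑ l ∈ tt, bb l • (gaugePhase (twistFlipExp (γ l) (fl l) (mt l)) (yw l) •
              fermionEmbed (PolySite.incl (hsh l))
                (fermionEmbed (PolySite.d4Emb (γ l) (wv l) Λ) (spinSwapIter (fl l).val (ladderWord (yw l)))) -
            fermionEmbed (PolySite.incl hΛ) (ladderWord (yw l)))) +
        (∑ m' ∈ ah, ((dc m' : ℝ) : ℂ) • ((V m')ᴴ - V m') + ∑ k ∈ w, a k • ladderWord (word k)) +
        kktForm (pairSourceWindowHamiltonianTT' dWaveFormFactor Λ' t' U 0 h) G
          (fun b' => fermionEmbed (PolySite.incl hΛ) (Bk b'))) :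
    ∀ ω : InfVolFermionState 2, ω.IsTranslationInvariant → ω.density = n →
      (∀ σ : InfVolFermionState 2, σ.IsTranslationInvariant → σ.density = n →
        ω.meanEnergy (hubbardTTPrimeSourcedInteraction 1 t' U 0 dWaveFormFactor h) 1 ≤
          σ.meanEnergy (hubbardTTPrimeSourcedInteraction 1 t' U 0 dWaveFormFactor h) 1) →
      mfl ≤ (ω.expect (pairRegion (insert (0 : Site 2) unitSteps) 0)
        (localPairAt (insert (0 : Site 2) unitSteps) dWaveFormFactor 0)).re := by
  intro ω hω hωρ hmin
  have hF : ∀ σ : InfVolFermionState 2, σ.IsTranslationInvariant → σ.density = ω.density →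
      ∀ j ∈ Jf, κf j * ((lf j : ℚ) : ℝ) ≤
        κf j * σ.meanEnergy (hubbardTTPrimeSourcedInteraction 1 t' U 0 dWaveFormFactor (hf j)) 1 :=
    fun σ hσ hσρ j hj => mul_le_mul_of_nonneg_left (hE j hj σ hσ (hσρ.trans hωρ)) (hκf j hj)
  have hcert' : (fermionEmbed (PolySite.incl hP) (localPairAt (insert (0 : Site 2) unitSteps) dWaveFormFactor 0) +
          (fermionEmbed (PolySite.incl hP) (localPairAt (insert (0 : Site 2) unitSteps) dWaveFormFactor 0))ᴴ) -
        (c : ℂ) • (1 : FermionOp Λ') -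
        ∑ σ : Fin 2, ((μc σ : ℝ) : ℂ) • (nAt 0 hz σ - (((n / 2 : ℝ) : ℝ) : ℂ) • (1 : FermionOp Λ')) -
        ((κp : ℝ) : ℂ) • ((((u : ℚ) : ℝ) : ℂ) • (1 : FermionOp Λ') -
          fermionEmbed (PolySite.incl h0) ((hubbardTTPrimeSourcedInteraction 1 t' U 0 dWaveFormFactor h).meanEnergyObs 1)) -
        (((0 : ℝ) : ℝ) : ℂ) • (fermionEmbed (PolySite.incl h0) ((hubbardTTPrimeFermionInteraction 1 t' U).meanEnergyObs 1) -
          (((0 : ℝ) : ℝ) : ℂ) • (1 : FermionOp Λ')) -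
        ∑ j ∈ Jf, ((κf j : ℝ) : ℂ) •
          (fermionEmbed (PolySite.incl h0) ((hubbardTTPrimeSourcedInteraction 1 t' U 0 dWaveFormFactor (hf j)).meanEnergyObs 1) -
            ((((lf j : ℚ) : ℝ) : ℝ) : ℂ) • (1 : FermionOp Λ')) =
      gramForm Λm O +
        (∑ k ∈ s, (pairSourceWindowHamiltonianTT' dWaveFormFactor Λ' t' U 0 h * fermionEmbed (PolySite.incl hΛ) (B k) -
            fermionEmbed (PolySite.incl hΛ) (B k) * pairSourceWindowHamiltonianTT' dWaveFormFactor Λ' t' U 0 h) +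
          ∑ l ∈ tt, bb l • (gaugePhase (twistFlipExp (γ l) (fl l) (mt l)) (yw l) •
              fermionEmbed (PolySite.incl (hsh l))
                (fermionEmbed (PolySite.d4Emb (γ l) (wv l) Λ) (spinSwapIter (fl l).val (ladderWord (yw l)))) -
            fermionEmbed (PolySite.incl hΛ) (ladderWord (yw l)))) +
        (∑ m' ∈ ah, ((dc m' : ℝ) : ℂ) • ((V m')ᴴ - V m') + ∑ k ∈ w, a k • ladderWord (word k)) +
        kktForm (pairSourceWindowHamiltonianTT' dWaveFormFactor Λ' t' U 0 h) G
          (fun b' => fermionEmbed (PolySite.incl hΛ) (Bk b')) := by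
    rw [Complex.ofReal_zero, zero_smul, sub_zero]; exact hcert
  have hmain := hω.re_sum_twistedFlipAct_expect_ge_of_sourced_certificate_kkt_canonical_fieldRows hωρ hn0 hn2 hmin hΛ h8 h0 hz _
    κp 0 ((u : ℚ) : ℝ) 0 μc (n / 2) (mul_meanEnergy_sourced_le_of_canonicalCap hmin hκ hcapW)
    (fun _ _ _ => by simp only [zero_mul, le_refl]) Jf κf hf (fun j => ((lf j : ℚ) : ℝ)) hF hΛm O s B hB tt γ wv fl mt hsh
    bb yw ah dc V w a word hG Bk hBk hcert'
  simp_rw [re_expect_fermionEmbed_localPairAt_add_conjTranspose, ← Finset.mul_sum,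
    ω.sum_re_expect_localPairAt_dWave_twistedFlipAct] at hmain
  rw [hωρ, sub_self, mul_zero, add_zero] at hmain
  linarith

/-- **CANONICAL «KKT + ENERGY ROWS» CEILING NODE SHAPE** (MAX twin, slot `−(c − Σ‖aₖ‖) ≤ 2M`): for every density-`n` minimiser `ω` of
`e^{src}_{0,h}`, `Re ω(P₀^d) ≤ M`. [cite: KomaTasaki1994, §1] [cite: WangEtAl2024, §III] -/
theorem canonicalClass_re_expect_localPairAt_le_of_twistedFlip_certificate_kkt_of_energyNodes (t' U h n : ℝ) (hn0 : 0 < n)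
    (hn2 : n < 2) {Λ Λ' : Finset (Site 2)} (hΛ : Λ ⊆ Λ') (h8 : thicken Λ 1 ⊆ Λ') (h0 : thicken ({0} : Finset (Site 2)) 1 ⊆ Λ')
    (hz : (0 : Site 2) ∈ Λ') (hP : pairRegion (insert (0 : Site 2) unitSteps) 0 ⊆ Λ') {κp : ℝ} (hκ : 0 ≤ κp) {u : ℚ}
    (hcapW : ∃ σ : InfVolFermionState 2, σ.IsTranslationInvariant ∧ σ.density = n ∧
      σ.meanEnergy (hubbardTTPrimeSourcedInteraction 1 t' U 0 dWaveFormFactor h) 1 ≤ ((u : ℚ) : ℝ))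
    {J : Type*} (Jf : Finset J) (κf hf : J → ℝ) (lf : J → ℚ) (hκf : ∀ j ∈ Jf, 0 ≤ κf j)
    (hE : ∀ j ∈ Jf, ∀ σ : InfVolFermionState 2, σ.IsTranslationInvariant → σ.density = n →
      ((lf j : ℚ) : ℝ) ≤ σ.meanEnergy (hubbardTTPrimeSourcedInteraction 1 t' U 0 dWaveFormFactor (hf j)) 1)
    (μc : Fin 2 → ℝ)
    {m : Type*} [Fintype m] [DecidableEq m] {Λm : Matrix m m ℂ} (hΛm : Λm.PosSemidef) (O : m → FermionOp Λ')
    {κ' : Type*} (s : Finset κ') (B : κ' → FermionOp Λ) (hB : ∀ k ∈ s, Commute (totalNumber : FermionOp Λ) (B k))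
    {ι : Type*} (tt : Finset ι) (γ : ι → DihedralGroup 4) (wv : ι → Site 2) (fl mt : ι → Fin 2)
    (hsh : ∀ l, d4ShiftSet (γ l) (wv l) Λ ⊆ Λ') (bb : ι → ℂ) (yw : ι → List (Orb (PolySite Λ) × Bool))
    {δ : Type*} (ah : Finset δ) (dc : δ → ℝ) (V : δ → FermionOp Λ')
    {κ'' : Type*} (w : Finset κ'') (a : κ'' → ℂ) (word : κ'' → List (Orb (PolySite Λ') × Bool))
    {β : Type*} [Fintype β] [DecidableEq β] {G : Matrix β β ℂ} (hG : G.PosSemidef) (Bk : β → FermionOp Λ)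
    (hBk : ∀ b, Commute (totalNumber : FermionOp Λ) (Bk b)) {c M : ℝ} (hM : -(c - ∑ k ∈ w, ‖a k‖) ≤ 2 * M)
    (hcert : -(fermionEmbed (PolySite.incl hP) (localPairAt (insert (0 : Site 2) unitSteps) dWaveFormFactor 0) +
          (fermionEmbed (PolySite.incl hP) (localPairAt (insert (0 : Site 2) unitSteps) dWaveFormFactor 0))ᴴ) -
        (c : ℂ) • (1 : FermionOp Λ') -
        ∑ σ : Fin 2, ((μc σ : ℝ) : ℂ) • (nAt 0 hz σ - (((n / 2 : ℝ) : ℝ) : ℂ) • (1 : FermionOp Λ')) -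
        ((κp : ℝ) : ℂ) • ((((u : ℚ) : ℝ) : ℂ) • (1 : FermionOp Λ') -
          fermionEmbed (PolySite.incl h0) ((hubbardTTPrimeSourcedInteraction 1 t' U 0 dWaveFormFactor h).meanEnergyObs 1)) -
        ∑ j ∈ Jf, ((κf j : ℝ) : ℂ) •
          (fermionEmbed (PolySite.incl h0) ((hubbardTTPrimeSourcedInteraction 1 t' U 0 dWaveFormFactor (hf j)).meanEnergyObs 1) -
            (((lf j : ℚ) : ℝ) : ℂ) • (1 : FermionOp Λ')) =
      gramForm Λm O +
        (∑ k ∈ s, (pairSourceWindowHamiltonianTT' dWaveFormFactor Λ' t' U 0 h * fermionEmbed (PolySite.incl hΛ) (B k) -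
            fermionEmbed (PolySite.incl hΛ) (B k) * pairSourceWindowHamiltonianTT' dWaveFormFactor Λ' t' U 0 h) +
          ∑ l ∈ tt, bb l • (gaugePhase (twistFlipExp (γ l) (fl l) (mt l)) (yw l) •
              fermionEmbed (PolySite.incl (hsh l))
                (fermionEmbed (PolySite.d4Emb (γ l) (wv l) Λ) (spinSwapIter (fl l).val (ladderWord (yw l)))) -
            fermionEmbed (PolySite.incl hΛ) (ladderWord (yw l)))) +
        (∑ m' ∈ ah, ((dc m' : ℝ) : ℂ) • ((V m')ᴴ - V m') + ∑ k ∈ w, a k • ladderWord (word k)) +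
        kktForm (pairSourceWindowHamiltonianTT' dWaveFormFactor Λ' t' U 0 h) G
          (fun b' => fermionEmbed (PolySite.incl hΛ) (Bk b'))) :
    ∀ ω : InfVolFermionState 2, ω.IsTranslationInvariant → ω.density = n →
      (∀ σ : InfVolFermionState 2, σ.IsTranslationInvariant → σ.density = n →
        ω.meanEnergy (hubbardTTPrimeSourcedInteraction 1 t' U 0 dWaveFormFactor h) 1 ≤
          σ.meanEnergy (hubbardTTPrimeSourcedInteraction 1 t' U 0 dWaveFormFactor h) 1) →
      (ω.expect (pairRegion (insert (0 : Site 2) unitSteps) 0)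
        (localPairAt (insert (0 : Site 2) unitSteps) dWaveFormFactor 0)).re ≤ M := by
  intro ω hω hωρ hmin
  have hF : ∀ σ : InfVolFermionState 2, σ.IsTranslationInvariant → σ.density = ω.density →
      ∀ j ∈ Jf, κf j * ((lf j : ℚ) : ℝ) ≤
        κf j * σ.meanEnergy (hubbardTTPrimeSourcedInteraction 1 t' U 0 dWaveFormFactor (hf j)) 1 :=
    fun σ hσ hσρ j hj => mul_le_mul_of_nonneg_left (hE j hj σ hσ (hσρ.trans hωρ)) (hκf j hj)
  have hcert' : -(fermionEmbed (PolySite.incl hP) (localPairAt (insert (0 : Site 2) unitSteps) dWaveFormFactor 0) +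
          (fermionEmbed (PolySite.incl hP) (localPairAt (insert (0 : Site 2) unitSteps) dWaveFormFactor 0))ᴴ) -
        (c : ℂ) • (1 : FermionOp Λ') -
        ∑ σ : Fin 2, ((μc σ : ℝ) : ℂ) • (nAt 0 hz σ - (((n / 2 : ℝ) : ℝ) : ℂ) • (1 : FermionOp Λ')) -
        ((κp : ℝ) : ℂ) • ((((u : ℚ) : ℝ) : ℂ) • (1 : FermionOp Λ') -
          fermionEmbed (PolySite.incl h0) ((hubbardTTPrimeSourcedInteraction 1 t' U 0 dWaveFormFactor h).meanEnergyObs 1)) -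
        (((0 : ℝ) : ℝ) : ℂ) • (fermionEmbed (PolySite.incl h0) ((hubbardTTPrimeFermionInteraction 1 t' U).meanEnergyObs 1) -
          (((0 : ℝ) : ℝ) : ℂ) • (1 : FermionOp Λ')) -
        ∑ j ∈ Jf, ((κf j : ℝ) : ℂ) •
          (fermionEmbed (PolySite.incl h0) ((hubbardTTPrimeSourcedInteraction 1 t' U 0 dWaveFormFactor (hf j)).meanEnergyObs 1) -
            ((((lf j : ℚ) : ℝ) : ℝ) : ℂ) • (1 : FermionOp Λ')) =
      gramForm Λm O +
        (∑ k ∈ s, (pairSourceWindowHamiltonianTT' dWaveFormFactor Λ' t' U 0 h * fermionEmbed (PolySite.incl hΛ) (B k) -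
            fermionEmbed (PolySite.incl hΛ) (B k) * pairSourceWindowHamiltonianTT' dWaveFormFactor Λ' t' U 0 h) +
          ∑ l ∈ tt, bb l • (gaugePhase (twistFlipExp (γ l) (fl l) (mt l)) (yw l) •
              fermionEmbed (PolySite.incl (hsh l))
                (fermionEmbed (PolySite.d4Emb (γ l) (wv l) Λ) (spinSwapIter (fl l).val (ladderWord (yw l)))) -
            fermionEmbed (PolySite.incl hΛ) (ladderWord (yw l)))) +
        (∑ m' ∈ ah, ((dc m' : ℝ) : ℂ) • ((V m')ᴴ - V m') + ∑ k ∈ w, a k • ladderWord (word k)) +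
        kktForm (pairSourceWindowHamiltonianTT' dWaveFormFactor Λ' t' U 0 h) G
          (fun b' => fermionEmbed (PolySite.incl hΛ) (Bk b')) := by
    rw [Complex.ofReal_zero, zero_smul, sub_zero]; exact hcert
  have hmain := hω.re_sum_twistedFlipAct_expect_ge_of_sourced_certificate_kkt_canonical_fieldRows hωρ hn0 hn2 hmin hΛ h8 h0 hz _
    κp 0 ((u : ℚ) : ℝ) 0 μc (n / 2) (mul_meanEnergy_sourced_le_of_canonicalCap hmin hκ hcapW)
    (fun _ _ _ => by simp only [zero_mul, le_refl]) Jf κf hf (fun j => ((lf j : ℚ) : ℝ)) hF hΛm O s B hB tt γ wv fl mt hsh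
    bb yw ah dc V w a word hG Bk hBk hcert'
  simp_rw [map_neg, Complex.neg_re, re_expect_fermionEmbed_localPairAt_add_conjTranspose, Finset.sum_neg_distrib,
    ← Finset.mul_sum, ω.sum_re_expect_localPairAt_dWave_twistedFlipAct] at hmain
  rw [hωρ, sub_self, mul_zero, add_zero] at hmain
  linarith

end Summit.Ventures.CertifiedManyBodySolver

end
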